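import Literature.Barriers.CriticalPhenomena.GridSAWTiledDrawing
import Literature.Barriers.CriticalPhenomena.GridSAWStructuredDrawingBlocks
import Literature.Computability.Complexity.CodeFPListKit
import HarnessLib

/-!
# Drawings assembled from placed tiles: their data, and the data in typed polynomial time

Support for the drawing step `E₀` of `GridSAW.LOT2003_lemma4_gadgets` (Liśkiewicz–Ogihara–Toda 2003,
Lemma 4 with the embedding of the proof of Theorem 7), continuing `GridSAWTiledDrawing.lean`: the
polynomial-time end of a tiling. A construction that places finitely many tiles
(`GridSAW.Placement`: tile, origin, global names of the local vertices) hands the drawing to the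
machine as a list of PLACEMENT DATA `PData = (local positions, local edges, origin, names)`; this
file turns such a list into the `NamedDrawingData` consumed by `LOT2003_lemma4_gadgets_of_family`
(`GridSAWGadgetsFromDrawnFamily.lean`) and shows that the transformation is typed polynomial time
(`CodeFP`), so that a construction only has to produce its list of placement data in `CodeFP`:

* `PData`, `PData.ofPlacement`, `PData.gedgesD`, `PData.edgesD` (the assembled edge list),
  `PData.posIn`, `PData.posD` (the position of a global vertex: the first tile listing it),
  `PData.ndOfData` (vertices `0, …, nV - 1`, their positions, the edges, the two ends);
* `Placement.gedges_eq_gedgesD`, **`assemble_edges_eq_edgesD`** — the assembled edge list of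
  `GridSAWTiledDrawing.assemble` is `edgesD` of the placement data (valid tiles);
* **`TilingHyps.posD_eq`** — under the tiling hypotheses, `posD` agrees with the global position
  function on the vertices, and `TilingHyps.of_pos_congr` transports the hypotheses along such an
  agreement; hence `TilingHyps.assemble_posD_isValid`;
* `codeFP_gedgesD`, `codeFP_edgesD`, `codeFP_posIn`, `codeFP_posD`, **`codeFP_ndOfData`** — all of
  it is typed polynomial time in the raw code `pdC` of the placement data (with the number of
  vertices in unary).

## References

* M. Liśkiewicz, M. Ogihara, S. Toda, TCS 304 (2003) 129–156, §4 (proof of Theorem 7: `E₀` is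
  computed in polynomial time).
* S. Arora, B. Barak, *Computational Complexity: A Modern Approach*, CUP 2009, §1.3.
-/

namespace Literature.Barriers.CriticalPhenomena.GridSAW

open _root_.Computability Literature.Computability.Complexity Literature.Computability.Complexity.CodeFP

/-- **Placement data**: local positions, local edges, origin, global names of the local vertices. [folklore] -/
abbrev PData : Type := List GridPoint × List (ℕ × ℕ × List GridPoint) × GridPoint × List ℕ

namespace PData

/-- The data of a placement. [folklore] -/
def ofPlacement (P : Placement) : PData := (P.T.pos, P.T.edges, P.o, (List.range P.T.nv).map P.ν)

/-- The global edges of one placement datum: ends renamed, path translated. [folklore] -/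
def gedgesD (d : PData) : List (SEdge ℕ) :=
  d.2.1.map fun e => (d.2.2.2.getD e.1 0, d.2.2.2.getD e.2.1 0, e.2.2.map (SDrawing.shift d.2.2.1))

/-- **The assembled edge list** of a list of placement data. [folklore] -/
def edgesD (D : List PData) : List (SEdge ℕ) := (D.map gedgesD).flatten

/-- The position of global vertex `v` in one placement datum, if it lists `v`. [folklore] -/
def posIn (d : PData) (v : ℕ) : Option GridPoint :=
  if d.2.2.2.idxOf v < d.2.2.2.length then some (SDrawing.shift d.2.2.1 (d.1.getD (d.2.2.2.idxOf v) (0, 0))) else none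

/-- **The position of global vertex `v`**: read off the first placement datum listing it. [folklore] -/
def posD (D : List PData) (v : ℕ) : GridPoint := (D.findSome? fun d => posIn d v).getD (0, 0)

/-- **The named drawing data** of a list of placement data with `nV` vertices and ends `s, t`. [folklore] -/
def ndOfData (D : List PData) (nV s t : ℕ) : NamedDrawingData :=
  (List.range nV, (List.range nV).map (posD D), edgesD D, s, t)

/-! ### The assembled drawing in terms of the data -/

/-- Entries of a mapped range. [folklore] -/
theorem getD_map_range {β : Type} (f : ℕ → β) {n i : ℕ} (hi : i < n) (d : β) : ((List.range n).map f).getD i d = f i := by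
  rw [List.getD_eq_getElem _ _ (by simpa using hi)]
  simp

/-- The translation of a placement is the translation by its origin. [folklore] -/
theorem shift_eq (P : Placement) (p : GridPoint) : P.shift p = SDrawing.shift P.o p := by
  unfold Placement.shift SDrawing.shift; ext <;> simp [add_comm]

/-- **The global edges of a placement with a valid tile are `gedgesD` of its data.** [folklore] -/
theorem _root_.Literature.Barriers.CriticalPhenomena.GridSAW.Placement.gedges_eq_gedgesD (P : Placement) (hT : P.T.Valid) :
    P.gedges = gedgesD (ofPlacement P) := by
  unfold Placement.gedges gedgesD ofPlacement
  refine List.map_congr_left fun e he => ?_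
  obtain ⟨h1, h2, -⟩ := hT.edge he
  simp only [getD_map_range _ h1, getD_map_range _ h2]
  congr 1; congr 1
  exact List.map_congr_left fun p _ => shift_eq P p

/-- **The assembled edge list is `edgesD` of the placement data** (valid tiles). [folklore] -/
theorem assemble_edges_eq_edgesD (L : List Placement) (hL : ∀ P ∈ L, P.T.Valid) (nV : ℕ) (g : ℕ → GridPoint) :
    (assemble L nV g).edges = edgesD (L.map ofPlacement) := by
  unfold assemble edgesD
  simp only [List.flatMap_def, List.map_map]
  congr 1
  exact List.map_congr_left fun P hP => P.gedges_eq_gedgesD (hL P hP)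

/-- What `posIn` finds. [folklore] -/
theorem posIn_eq_some {P : Placement} {v : ℕ} {p : GridPoint} (h : posIn (ofPlacement P) v = some p) :
    ∃ i, ∃ hi : i < P.T.nv, P.ν i = v ∧ p = P.shift P.T.pos[i] := by
  unfold posIn ofPlacement at h
  simp only [List.length_map, List.length_range] at h
  by_cases hlt : ((List.range P.T.nv).map P.ν).idxOf v < P.T.nv
  · rw [if_pos hlt] at h
    set i := ((List.range P.T.nv).map P.ν).idxOf v with hi
    have hmem : v ∈ (List.range P.T.nv).map P.ν := by
      by_contra hn
      rw [List.idxOf_of_notMem hn] at hi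
      simp at hi; omega
    have hget : ((List.range P.T.nv).map P.ν)[i]'(by simpa using hlt) = v := List.getElem_idxOf (List.idxOf_lt_length_of_mem hmem)
    simp only [List.getElem_map, List.getElem_range] at hget
    refine ⟨i, hlt, hget, ?_⟩
    simp only [Option.some.injEq] at h
    rw [← h, shift_eq, List.getD_eq_getElem _ _ hlt]
  · rw [if_neg hlt] at h; exact absurd h (by simp)

/-- `posIn` finds every listed vertex. [folklore] -/
theorem posIn_isSome {P : Placement} {i : ℕ} (hi : i < P.T.nv) : (posIn (ofPlacement P) (P.ν i)).isSome = true := by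
  unfold posIn ofPlacement
  have hmem : P.ν i ∈ (List.range P.T.nv).map P.ν := List.mem_map.2 ⟨i, List.mem_range.2 hi, rfl⟩
  have := List.idxOf_lt_length_of_mem hmem
  simp only [List.length_map, List.length_range] at this ⊢
  rw [if_pos this]; rfl

variable {L : List Placement} {nV : ℕ} {gpos : ℕ → GridPoint}

/-- **Under the tiling hypotheses `posD` is the global position** of every vertex. [folklore] -/
theorem _root_.Literature.Barriers.CriticalPhenomena.GridSAW.TilingHyps.posD_eq (H : TilingHyps L nV gpos) {v : ℕ} (hv : v < nV) :
    posD (L.map ofPlacement) v = gpos v := by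
  unfold posD
  cases h : (L.map ofPlacement).findSome? fun d => posIn d v with
  | none =>
    exfalso
    obtain ⟨P, hP, i, hi, rfl⟩ := H.cover v hv
    rw [List.findSome?_eq_none_iff] at h
    have := h (ofPlacement P) (List.mem_map.2 ⟨P, hP, rfl⟩)
    have h2 := posIn_isSome (P := P) hi
    rw [this] at h2; exact absurd h2 (by simp)
  | some p =>
    obtain ⟨d, hd, hdp⟩ := List.exists_of_findSome?_eq_some h
    obtain ⟨P, hP, rfl⟩ := List.mem_map.1 hd
    obtain ⟨i, hi, rfl, rfl⟩ := posIn_eq_some hdp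
    simp only [Option.getD_some]
    exact ((H.pos_eq P hP i hi).2).symm

/-- **Transport of the tiling hypotheses** along an agreement of position functions on the vertices. [folklore] -/
theorem _root_.Literature.Barriers.CriticalPhenomena.GridSAW.TilingHyps.of_pos_congr (H : TilingHyps L nV gpos)
    {g : ℕ → GridPoint} (hg : ∀ v < nV, g v = gpos v) : TilingHyps L nV g where
  nodup := H.nodup
  valid := H.valid
  pos_eq := fun P hP i hi => ⟨(H.pos_eq P hP i hi).1, by rw [hg _ (H.pos_eq P hP i hi).1]; exact (H.pos_eq P hP i hi).2⟩
  boxes := H.boxes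
  crosslist := H.crosslist
  shared := H.shared
  cover := H.cover
  degree := H.degree

/-- **The drawing assembled with `posD` as position function is valid** under the tiling hypotheses. [folklore] -/
theorem _root_.Literature.Barriers.CriticalPhenomena.GridSAW.TilingHyps.assemble_posD_isValid (H : TilingHyps L nV gpos) :
    (assemble L nV (posD (L.map ofPlacement))).IsValid :=
  assemble_isValid (H.of_pos_congr fun _ hv => H.posD_eq hv)

/-- The data of the drawing assembled with `posD`, as `ndOfData`. [folklore] -/
theorem assemble_data_eq (hL : ∀ P ∈ L, P.T.Valid) (s t : ℕ) :
    ((assemble L nV (posD (L.map ofPlacement))).verts,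
      (assemble L nV (posD (L.map ofPlacement))).verts.map (assemble L nV (posD (L.map ofPlacement))).pos,
      (assemble L nV (posD (L.map ofPlacement))).edges, s, t) = ndOfData (L.map ofPlacement) nV s t := by
  unfold ndOfData
  rw [assemble_edges_eq_edgesD L hL]
  rfl

/-! ### The data in typed polynomial time -/

/-- The raw code of placement data. [cite: AroraBarak2009, §0.1] -/
abbrev pdC : PData → List Bool := pairE (rawE gpC) (pairE (rawE sedgeC) (pairE gpC (rawE natE)))

/-- Renaming the two ends and translating the path of one local edge (context: origin, names). [cite: AroraBarak2009, §1.3] -/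
theorem codeFP_gedge : CodeFP (pairE (pairE gpC (rawE natE)) sedgeC) sedgeC
    (fun q => (q.1.2.getD q.2.1 0, q.1.2.getD q.2.2.1 0, q.2.2.2.map (SDrawing.shift q.1.1))) := by
  have hν : CodeFP (pairE (pairE gpC (rawE natE)) sedgeC) (rawE natE) (fun q => q.1.2) := (fst _ _).snd'
  have ho : CodeFP (pairE (pairE gpC (rawE natE)) sedgeC) gpC (fun q => q.1.1) := (fst _ _).fst'
  have ha : CodeFP (pairE (pairE gpC (rawE natE)) sedgeC) natE (fun q => q.2.1) := (snd _ _).fst'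
  have hb : CodeFP (pairE (pairE gpC (rawE natE)) sedgeC) natE (fun q => q.2.2.1) := (snd _ _).snd'.fst'
  have hπ : CodeFP (pairE (pairE gpC (rawE natE)) sedgeC) (rawE gpC) (fun q => q.2.2.2) := (snd _ _).snd'.snd'
  have g1 := (rawGetD natE (d := 0) rfl).comp (hν.pair ha)
  have g2 := (rawGetD natE (d := 0) rfl).comp (hν.pair hb)
  exact (g1.pair (g2.pair (SDrawing.codeFP_shiftPath.comp (ho.pair hπ)))).congr fun _ => rfl

/-- **`gedgesD` is typed polynomial time.** [cite: AroraBarak2009, §1.3] -/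
theorem codeFP_gedgesD : CodeFP pdC (rawE sedgeC) gedgesD := by
  have hctx : CodeFP pdC (pairE gpC (rawE natE)) (fun d => (d.2.2.1, d.2.2.2)) := (snd _ _).snd'.fst'.pair (snd _ _).snd'.snd'
  have hE : CodeFP pdC (rawE sedgeC) (fun d => d.2.1) := (snd _ _).fst'
  exact ((map codeFP_gedge).comp (hctx.pair hE)).congr fun _ => rfl

/-- **`edgesD` is typed polynomial time.** [cite: AroraBarak2009, §1.3] -/
theorem codeFP_edgesD : CodeFP (rawE pdC) (rawE sedgeC) edgesD :=
  ((flatten sedgeC).comp (map₀ codeFP_gedgesD)).congr fun _ => rfl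

/-- **`posIn` is typed polynomial time** (context: the vertex). [cite: AroraBarak2009, §1.3] -/
theorem codeFP_posIn : CodeFP (pairE natE pdC) (optE gpC) (fun q => posIn q.2 q.1) := by
  have hν : CodeFP (pairE natE pdC) (rawE natE) (fun q => q.2.2.2.2) := (snd _ _).snd'.snd'.snd'
  have ho : CodeFP (pairE natE pdC) gpC (fun q => q.2.2.2.1) := (snd _ _).snd'.snd'.fst'
  have hP : CodeFP (pairE natE pdC) (rawE gpC) (fun q => q.2.1) := (snd _ _).fst'
  have hv : CodeFP (pairE natE pdC) natE (fun q => q.1) := fst _ _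
  have hidx : CodeFP (pairE natE pdC) natE (fun q => q.2.2.2.2.idxOf q.1) := (codeFP_idxOf.comp (hv.pair hν)).congr fun _ => rfl
  have hlen : CodeFP (pairE natE pdC) natE (fun q => q.2.2.2.2.length) := (natLength natE).comp hν
  have hlt : CodeFP (pairE natE pdC) bitE (fun q => decide (q.2.2.2.2.idxOf q.1 < q.2.2.2.2.length)) :=
    natLt.comp (hidx.pair hlen)
  have hget : CodeFP (pairE natE pdC) gpC (fun q => q.2.1.getD (q.2.2.2.2.idxOf q.1) (0, 0)) :=
    ((rawGetOr gpC).comp (hP.pair (hidx.pair (const _ ((0 : ℤ), (0 : ℤ)))))).congr fun _ => rfl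
  -- (no type ascription: unifying through `SDrawing.shift` is expensive; `congr` below closes by `simp`)
  have hsh := SDrawing.codeFP_shift.comp (ho.pair hget)
  exact (ite hlt ((optSome gpC).comp hsh) (const _ none)).congr fun q => by
    unfold posIn; by_cases h : q.2.2.2.2.idxOf q.1 < q.2.2.2.2.length <;> simp [h]

/-- **`posD` is typed polynomial time** (context: the vertex). [cite: AroraBarak2009, §1.3] -/
theorem codeFP_posD : CodeFP (pairE natE (rawE pdC)) gpC (fun q => posD q.2 q.1) := by
  have hfind : CodeFP (pairE natE (rawE pdC)) (optE gpC) (fun q => q.2.findSome? fun d => posIn d q.1) :=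
    (findSomeFP (f := fun t : ℕ × PData => posIn t.2 t.1) codeFP_posIn).congr fun _ => rfl
  have hget : CodeFP (pairE natE (optE gpC)) gpC (fun q => q.2.getD (0, 0)) :=
    optCases (k := fun (_ : ℕ) (o : Option GridPoint) => o.getD (0, 0)) (gnone := fun _ => ((0 : ℤ), (0 : ℤ)))
      (gsome := fun t => t.2) (const _ _) (snd _ _) (fun _ => rfl) (fun _ _ => rfl)
  exact (hget.comp ((fst _ _).pair hfind)).congr fun _ => rfl

/-- **`ndOfData` is typed polynomial time** in the placement data, the number of vertices in unary
and the two ends. [cite: AroraBarak2009, §1.3] -/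
theorem codeFP_ndOfData : CodeFP (pairE (rawE pdC) (pairE unE (pairE natE natE))) ndC
    (fun q => ndOfData q.1 q.2.1 q.2.2.1 q.2.2.2) := by
  have hD : CodeFP (pairE (rawE pdC) (pairE unE (pairE natE natE))) (rawE pdC) (fun q => q.1) := fst _ _
  have hn : CodeFP (pairE (rawE pdC) (pairE unE (pairE natE natE))) unE (fun q => q.2.1) := (snd _ _).fst'
  have hs : CodeFP (pairE (rawE pdC) (pairE unE (pairE natE natE))) natE (fun q => q.2.2.1) := (snd _ _).snd'.fst'
  have ht : CodeFP (pairE (rawE pdC) (pairE unE (pairE natE natE))) natE (fun q => q.2.2.2) := (snd _ _).snd'.snd'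
  have hV : CodeFP (pairE (rawE pdC) (pairE unE (pairE natE natE))) (rawE natE) (fun q => List.range q.2.1) := urange.comp hn
  have hpos : CodeFP (pairE (rawE pdC) (pairE unE (pairE natE natE))) (rawE gpC) (fun q => (List.range q.2.1).map (posD q.1)) :=
    ((map (g := fun t : List PData × ℕ => posD t.1 t.2) ((codeFP_posD.comp ((snd _ _).pair (fst _ _))).congr fun _ => rfl)).comp
      (hD.pair hV)).congr fun _ => rfl
  exact (hV.pair (hpos.pair ((codeFP_edgesD.comp hD).pair (hs.pair ht)))).congr fun _ => rfl

end PData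

end Literature.Barriers.CriticalPhenomena.GridSAW
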